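import Mathlib
import Summits.Ventures.PercRepro.PuncturedLYMTypeLiftFamily
import Summits.Ventures.PercRepro.PuncturedLYMCoHypMain
import Summits.Ventures.PercRepro.PuncturedLYMQuadSymChecksRows2
import Summits.Ventures.PercRepro.PuncturedLYMQuadSymChecksCols2
import Summits.Ventures.PercRepro.PuncturedLYMQuadSymChecksMem3

/-!
# PercRepro — (SP) FOR FOUR PAIRWISE DISJOINT TRIPLES AT LEVEL 4 ON EVERY GROUND SET WITH `n ≥ 17` POINTS
(p10, gen 39)

THE THEOREM `puncturedNMP_four_triples_of_seventeen_le`: on `n = m + 17` points, for every four pairwise disjoint `3`-sets,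
(SP) holds at level `4` — the symbolic certificate of PuncturedLYMQuadSym* (101 rational-function entries) through the type
lift; `#P = C(n, 4) − 4 (n − 3)`, `#Y = C(n, 5)` as polynomials in `m`.
-/

namespace PercRepro.PuncturedLYM.Split.TypeLift.QuadSym

open Finset

/-- `a = ![a 0, a 1, a 2, a 3]`. -/
theorem eq_vec (a : Fin 4 → ℕ) : a = ![a 0, a 1, a 2, a 3] := by
  funext i; fin_cases i <;> rfl

/-- `Function.update a 0 v`. -/
theorem update_zero_eq (a : Fin 4 → ℕ) (v : ℕ) : Function.update a 0 v = ![v, a 1, a 2, a 3] := by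
  funext i; fin_cases i <;> simp

/-- `Function.update a 1 v`. -/
theorem update_one_eq (a : Fin 4 → ℕ) (v : ℕ) : Function.update a 1 v = ![a 0, v, a 2, a 3] := by
  funext i; fin_cases i <;> simp

/-- `Function.update a 2 v`. -/
theorem update_two_eq (a : Fin 4 → ℕ) (v : ℕ) : Function.update a 2 v = ![a 0, a 1, v, a 3] := by
  funext i; fin_cases i <;> simp

/-- `Function.update a 3 v`. -/
theorem update_three_eq (a : Fin 4 → ℕ) (v : ℕ) : Function.update a 3 v = ![a 0, a 1, a 2, v] := by
  funext i; fin_cases i <;> simp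

/-- The row equations for a row type given as a function. -/
theorem row_check' (m : ℚ) (hm : 0 ≤ m) (a : Fin 4 → ℕ) (c : ℕ) (h₀ : a 0 ≤ 2) (h₁ : a 1 ≤ 2) (h₂ : a 2 ≤ 2)
    (h₃ : a 3 ≤ 2) (hs : a 0 + a 1 + a 2 + a 3 + c = 4) :
    ((3 - a 0 : ℕ) : ℚ) * W m a c (some 0) + ((3 - a 1 : ℕ) : ℚ) * W m a c (some 1) +
      ((3 - a 2 : ℕ) : ℚ) * W m a c (some 2) + ((3 - a 3 : ℕ) : ℚ) * W m a c (some 3) +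
      (m + 5 - (c : ℚ)) * W m a c none = 1 / P m := by
  have key := row_check m hm (a 0) (a 1) (a 2) (a 3) c h₀ h₁ h₂ h₃ hs
  rw [← eq_vec a] at key
  exact key

/-- The free-column equations for a column type given as a function. -/
theorem col_free_check' (m : ℚ) (hm : 0 ≤ m) (b : Fin 4 → ℕ) (c : ℕ) (h₀ : b 0 ≤ 2) (h₁ : b 1 ≤ 2) (h₂ : b 2 ≤ 2)
    (h₃ : b 3 ≤ 2) (hs : b 0 + b 1 + b 2 + b 3 + c = 5) :
    (b 0 : ℚ) * W m (Function.update b 0 (b 0 - 1)) c (some 0) +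
      (b 1 : ℚ) * W m (Function.update b 1 (b 1 - 1)) c (some 1) +
      (b 2 : ℚ) * W m (Function.update b 2 (b 2 - 1)) c (some 2) +
      (b 3 : ℚ) * W m (Function.update b 3 (b 3 - 1)) c (some 3) + (c : ℚ) * W m b (c - 1) none = 1 / Y m := by
  have key := col_free_check m hm (b 0) (b 1) (b 2) (b 3) c h₀ h₁ h₂ h₃ hs
  rw [← update_zero_eq, ← update_one_eq, ← update_two_eq, ← update_three_eq, ← eq_vec b] at key
  exact key

/-- The member-column equations for a column type given as a function. -/
theorem col_member_check' (m : ℚ) (hm : 0 ≤ m) (b : Fin 4 → ℕ) (c : ℕ) (i₀ : Fin 4) (hi : b i₀ = 3)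
    (hl : ∀ l, l ≠ i₀ → b l ≤ 2) (hs : b 0 + b 1 + b 2 + b 3 + c = 5) :
    (3 : ℚ) * W m (Function.update b i₀ (b i₀ - 1)) c (some i₀) = 1 / Y m := by
  fin_cases i₀
  · simp only [Fin.zero_eta, Fin.isValue] at hi hl ⊢
    rw [update_zero_eq, hi]
    exact col_member_check m hm 2 (b 1) (b 2) (b 3) c 0 (by norm_num) (hl 1 (by decide)) (hl 2 (by decide))
      (hl 3 (by decide)) (by omega) (by simp)
  · simp only [Fin.mk_one, Fin.isValue] at hi hl ⊢
    rw [update_one_eq, hi]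
    exact col_member_check m hm (b 0) 2 (b 2) (b 3) c 1 (hl 0 (by decide)) (by norm_num) (hl 2 (by decide))
      (hl 3 (by decide)) (by omega) (by simp)
  · simp only [Fin.reduceFinMk, Fin.isValue] at hi hl ⊢
    rw [update_two_eq, hi]
    exact col_member_check m hm (b 0) (b 1) 2 (b 3) c 2 (hl 0 (by decide)) (hl 1 (by decide)) (by norm_num)
      (hl 3 (by decide)) (by omega) (by simp)
  · simp only [Fin.reduceFinMk, Fin.isValue] at hi hl ⊢
    rw [update_three_eq, hi]
    exact col_member_check m hm (b 0) (b 1) (b 2) 2 c 3 (hl 0 (by decide)) (hl 1 (by decide)) (hl 2 (by decide))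
      (by norm_num) (by omega) (by simp)

/-- `C(m + 17, 4)` as a polynomial. -/
theorem choose_four_cast (m : ℕ) :
    (((m + 17).choose 4 : ℕ) : ℚ) = ((m : ℚ) + 17) * ((m : ℚ) + 16) * ((m : ℚ) + 15) * ((m : ℚ) + 14) / 24 := by
  have h := Nat.descFactorial_eq_factorial_mul_choose (m + 17) 4
  simp only [Nat.descFactorial_succ, Nat.descFactorial_zero, Nat.factorial, mul_one] at h
  rw [show m + 17 - 3 = m + 14 by omega, show m + 17 - 2 = m + 15 by omega, show m + 17 - 1 = m + 16 by omega,
    show m + 17 - 0 = m + 17 by omega] at h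
  have h' := congrArg (fun x : ℕ => (x : ℚ)) h
  push_cast at h'
  linarith

/-- `C(m + 17, 5)` as a polynomial. -/
theorem choose_five_cast (m : ℕ) :
    (((m + 17).choose 5 : ℕ) : ℚ) =
      ((m : ℚ) + 17) * ((m : ℚ) + 16) * ((m : ℚ) + 15) * ((m : ℚ) + 14) * ((m : ℚ) + 13) / 120 := by
  have h := Nat.descFactorial_eq_factorial_mul_choose (m + 17) 5
  simp only [Nat.descFactorial_succ, Nat.descFactorial_zero, Nat.factorial, mul_one] at h
  rw [show m + 17 - 4 = m + 13 by omega, show m + 17 - 3 = m + 14 by omega, show m + 17 - 2 = m + 15 by omega,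
    show m + 17 - 1 = m + 16 by omega, show m + 17 - 0 = m + 17 by omega] at h
  have h' := congrArg (fun x : ℕ => (x : ℚ)) h
  push_cast at h'
  linarith

section Main

variable {α : Type} [DecidableEq α] [Fintype α]

/-- Two of the members' up-levels are disjoint. -/
theorem disjoint_upLevel_four (C : Fin 4 → Finset α) (hcard : ∀ i, (C i).card = 3)
    (hdisj : ∀ i l, i ≠ l → Disjoint (C i) (C l)) (i l : Fin 4) (hil : i ≠ l) :
    Disjoint (upLevel 4 (C i)) (upLevel 4 (C l)) := by
  rw [disjoint_left]
  intro X h1 h2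
  rw [mem_upLevel] at h1 h2
  have := card_le_card (union_subset h1.2 h2.2)
  rw [card_union_of_disjoint (hdisj i l hil), hcard, hcard, h1.1] at this
  omega

/-- `#P = C(n, 4) − 4·C(n − 3, 1) = P m`. -/
theorem card_punctured_sym (m : ℕ) (hn : Fintype.card α = m + 17) (C : Fin 4 → Finset α)
    (hcard : ∀ i, (C i).card = 3) (hdisj : ∀ i l, i ≠ l → Disjoint (C i) (C l)) :
    (((punctured 4 ((univ : Finset (Fin 4)).biUnion (fun i => upLevel 4 (C i)))).card : ℕ) : ℚ) = P m := by
  unfold punctured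
  have hsub : (univ : Finset (Fin 4)).biUnion (fun i => upLevel 4 (C i)) ⊆ (univ : Finset α).powersetCard 4 := by
    intro X hX
    obtain ⟨i, _, hXi⟩ := mem_biUnion.1 hX
    rw [mem_powersetCard]
    exact ⟨subset_univ X, (mem_upLevel.1 hXi).1⟩
  have hu : ∀ i, (upLevel 4 (C i)).card = m + 14 := by
    intro i
    rw [card_upLevel (by rw [hcard]; norm_num), hcard, hn]
    rw [show m + 17 - 3 = m + 14 by omega]
    exact Nat.choose_one_right _
  have hD : ((univ : Finset (Fin 4)).biUnion (fun i => upLevel 4 (C i))).card = 4 * (m + 14) := by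
    rw [card_biUnion (fun i _ l _ hil => disjoint_upLevel_four C hcard hdisj i l hil)]
    simp only [hu, sum_const, card_univ, Fintype.card_fin, smul_eq_mul]
  rw [card_sdiff_of_subset hsub, card_powersetCard, card_univ, hn, hD]
  have hle : 4 * (m + 14) ≤ (m + 17).choose 4 := by
    have := card_le_card hsub
    rw [card_powersetCard, card_univ, hn, hD] at this
    exact this
  rw [Nat.cast_sub hle, choose_four_cast]
  unfold P
  push_cast
  ring

omit [DecidableEq α] in
/-- `#Y = C(n, 5) = Y m`. -/
theorem card_levelAbove_sym (m : ℕ) (hn : Fintype.card α = m + 17) : (((levelAbove α 4).card : ℕ) : ℚ) = Y m := by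
  unfold levelAbove
  rw [card_powersetCard, card_univ, hn, choose_five_cast]
  unfold Y
  ring

/-- **THEOREM. (SP) for four pairwise disjoint `3`-sets at level `4` on every ground set with `n ≥ 17` points.** -/
theorem puncturedNMP_four_triples_of_seventeen_le (m : ℕ) (hn : Fintype.card α = m + 17)
    (C : Fin 4 → Finset α) (hcard : ∀ i, (C i).card = 3) (hdisj : ∀ i l, i ≠ l → Disjoint (C i) (C l)) :
    PuncturedNMP 4 ((univ : Finset (Fin 4)).biUnion (fun i => upLevel 4 (C i))) := by
  apply puncturedNMP_of_hasFlow
  rw [card_punctured_sym m hn C hcard hdisj, card_levelAbove_sym m hn]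
  have hm : (0 : ℚ) ≤ m := Nat.cast_nonneg m
  have hbig : ∀ i l, i ≠ l → 4 + 2 ≤ (C i).card + (C l).card := by
    intro i l _
    rw [hcard, hcard]
  have hfree : (freeSet C).card = m + 5 := by
    rw [card_freeSet hdisj, hn]
    simp only [hcard, sum_const, card_univ, Fintype.card_fin, smul_eq_mul]
    omega
  refine hasFlow_of_typeWeights C (fun X hX => card_eq_of_mem_punctured_family hX) _ _ (W m)
    (fun a c d => W_nonneg m hm a c d) ?_ ?_
  · -- the rows
    intro X hX
    have hX' := mem_punctured_family.1 hX
    have h0 := typ_lt_card_of_not_subset C (hX'.2 0)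
    have h1 := typ_lt_card_of_not_subset C (hX'.2 1)
    have h2 := typ_lt_card_of_not_subset C (hX'.2 2)
    have h3 := typ_lt_card_of_not_subset C (hX'.2 3)
    rw [hcard] at h0 h1 h2 h3
    have hs := sum_typ_add_fc hdisj X
    rw [Fin.sum_univ_four, hX'.1] at hs
    rw [rowSum_eq, Fin.sum_univ_four, card_sdiff_eq_sub_typ, card_sdiff_eq_sub_typ, card_sdiff_eq_sub_typ,
      card_sdiff_eq_sub_typ, card_freeSet_sdiff, hcard, hcard, hcard, hcard, hfree]
    have hcast : ((m + 5 - fc C X : ℕ) : ℚ) = (m : ℚ) + 5 - (fc C X : ℚ) := by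
      rw [Nat.cast_sub (by omega)]
      push_cast
      ring
    rw [hcast]
    exact row_check' m hm (typ C X) (fc C X) (by omega) (by omega) (by omega) (by omega) hs
  · -- the columns
    intro Y hY
    have hYc : Y.card = 4 + 1 := (mem_cols.1 hY).2
    have hs := sum_typ_add_fc hdisj Y
    rw [Fin.sum_univ_four, hYc] at hs
    by_cases hmem : ∃ i₀, C i₀ ⊆ Y
    · obtain ⟨i₀, hi₀⟩ := hmem
      rw [colSum_eq_of_member (W m) hdisj hbig hYc hi₀, hcard]
      have hi : typ C Y i₀ = 3 := by rw [typ_eq_card_of_subset C hi₀, hcard]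
      have hl : ∀ l, l ≠ i₀ → typ C Y l ≤ 2 := by
        intro l hl
        have hnot : ¬ C l ⊆ Y := by
          intro hCl
          have := card_le_card (union_subset hCl hi₀)
          rw [card_union_of_disjoint (hdisj l i₀ hl), hcard, hcard, hYc] at this
          omega
        have := typ_lt_card_of_not_subset C hnot
        rw [hcard] at this
        omega
      exact col_member_check' m hm (typ C Y) (fc C Y) i₀ hi hl hs
    · have hmem' : ∀ i, ¬ C i ⊆ Y := fun i h => hmem ⟨i, h⟩
      rw [colSum_eq_of_free (W m) hdisj hYc hmem', Fin.sum_univ_four]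
      have h0 := typ_lt_card_of_not_subset C (hmem' 0)
      have h1 := typ_lt_card_of_not_subset C (hmem' 1)
      have h2 := typ_lt_card_of_not_subset C (hmem' 2)
      have h3 := typ_lt_card_of_not_subset C (hmem' 3)
      rw [hcard] at h0 h1 h2 h3
      exact col_free_check' m hm (typ C Y) (fc C Y) (by omega) (by omega) (by omega) (by omega) hs

end Main

end PercRepro.PuncturedLYM.Split.TypeLift.QuadSym
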